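import Literature.Computability.AlgebraicComplexity.BorderRankCW
import Literature.Computability.AlgebraicComplexity.BorderRankRestriction
import Literature.Computability.AlgebraicComplexity.BorderRankCWDischarge
import Literature.Computability.AlgebraicComplexity.KoszulFlatteningBorderRank
import HarnessLib

/-!
# CGLV 2022, Thm. 1.2 for squares (and the `q = 2` cube): reduction to Koszul flattening ranks

Topic `Literature/Computability/AlgebraicComplexity`.  Step 3 of the provefact decomposition of the
named fact `CGLV2022_thm12` (`BorderRankCW.lean`; Conner–Gesmundo–Landsberg–Ventura, *Rank and border
rank of Kronecker powers of tensors and Strassen's laser method*, comput. complexity 31 (2022) =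
arXiv:1909.04785v2, Thm. 1.2).  With the tools now in the tree —

* upper bounds: `bR(T_{cw,q}) ≤ q + 2` (`BorderRankCWDischarge.lean`) and `bR(t^{⊠N}) ≤ bR(t)^N`
  (`BorderRankRestriction.lean`), assembled here as `algBorderRank_kroneckerPow_cwTensor_le` and
  `CGLV2022_thm12_upper` (CGLV: "the upper bound is immediate by submultiplicativity", §3.3);
* lower bounds: the Koszul flattening bound for the algebraic border rank,
  `C(2p,p) · bR(t) ≥ rank K_M(t)` (`KoszulFlatteningBorderRank.lean`, CGLV §3, eq. (8)) —

the first paragraph of Thm. 1.2 (Kronecker squares) and the `q = 2` case of the second (the cube)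
reduce to RANKS OF EXPLICIT INTEGER MATRICES, which this file vendors as named facts pending their
kernel certificates (all four were checked by exact modular Gaussian elimination when this file was
written; sizes and values below):

| fact | flattening | matrix | rank | source |
|---|---|---|---|---|
| `CGLV2022_thm33_koszulRank` | `p = 1`, `φ₂` of Thm. 3.3, `q ≥ 4` | `3(q+1)² × 3(q+1)²` | `2(q+2)²` | Thm. 3.3 (proof; printed) |
| `CGLV2022_koszulRank_sq_three` | `p = 2`, `cglvPhiSq3` (ours), `q = 3` | `160 × 160` | `≥ 150` | Thm. 3.3 (proof, `q = 3`: "direct calculation … sufficiently generic `ℂ⁵ ⊂ A*`") |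
| `CGLV2022_koszulRank_sq_two` | `p = 2`, `cglvPhiSq2` (ours), `q = 2` | `90 × 90` | `≥ 85` | §3.3, first paragraph ("follows from the `p = 2` Koszul flattening") |
| `CGLV2022_koszulRank_cube_two` | `p = 2`, `cglvPhiCube2` (ours), `T_{cw,2}^{⊠3}` | `270 × 270` | `≥ 265` | Thm. 1.2 (`q = 2`: `bR ≥ 15·3`; no proof printed) |

and the reductions `CGLV2022_thm12_square_of` (`CGLV2022_thm12_square` from the first three facts)
and `le_algBorderRank_cwTensor_two_cube_of` (`45 ≤ bR(T_{cw,2}^{⊠3})` from the fourth) are PROVED.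
For the "sufficiently generic `ℂ⁵`" of the source we fix explicit sparse `0/1` projections; the
generic ranks are `85` (not `90`), `150`, `265` respectively (so the flattening proves exactly
`bR ≥ 15`, `25`, `45`).

## Caveat recorded for the provefact item (third paragraph of Thm. 1.2, `q = 2`)

The printed proof of Thm. 1.2 ends with Cor. 3.5 (propagation, Prop. 3.2), which treats `q > 4` and
`q = 4` only.  For `q = 2` the generic `p = 2` flattening rank of `T_{cw,2}^{⊠2}` is `85`, and
Prop. 3.2 then yields only `bR(T_{cw,2}^{⊠N}) ≥ ⌈85·3^{N-2}/6⌉` (`= 43 < 45` for `N = 3`); the printed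
bounds `15·3^{N-2}` do follow for `N ≤ 5` from DIRECT `p = 2` flattenings of `T_{cw,2}^{⊠N}` (generic
ranks `10·3^N − 5 = 85, 265, 805, 2425`), but no argument for all `N` is printed.  (For `q = 3` the
rank `150 = 6·25` is divisible by `C(4,2)`, so Prop. 3.2 does give `25·4^{N-2}`.)

## Column conventions

Kronecker squares/cubes live on index types `Fin 2 → Fin (q+1)` / `Fin 3 → Fin (q+1)`
(`AsymptoticSpectrum.kroneckerPow`); a projection `A^{⊗N} → K^{2p+1}` is a matrix
`Matrix (Fin (2p+1)) (Fin N → Fin (q+1)) K`, column `a` standing for `a_{a 0, a 1(, a 2)}`, fed to the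
tree's `koszulFlattening p M.mulVecLin` (`MatMulRankLowerBoundsProofs.lean`).
-/

noncomputable section

open scoped BigOperators

namespace Literature.Computability.AlgebraicComplexity

universe u

/-! ## Upper bounds -/

section Upper

variable (K : Type u) [CommRing K]

/-- **`bR(T_{cw,q}^{⊠N}) ≤ (q + 2)^N`** over every commutative ring: `bR(T_{cw,q}) ≤ q + 2`
(Coppersmith–Winograd) and submultiplicativity of border rank under `⊠`.
[cite: ConnerGesmundoLandsbergVentura2022, Thm. 1.2] -/
theorem algBorderRank_kroneckerPow_cwTensor_le (q N : ℕ) :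
    algBorderRank (kroneckerPow (cwTensor K q) N) ≤ (q + 2) ^ N :=
  (algBorderRank_kroneckerPow_le _ N).trans (Nat.pow_le_pow_left (algBorderRank_cwTensor_le K q) N)

end Upper

/-- **CGLV 2022, Thm. 1.2 — the upper bounds** (over `ℂ`): `bR(T_{cw,q}^{⊠2}) ≤ (q+2)²` and
`bR(T_{cw,q}^{⊠3}) ≤ (q+2)³` for all `q`, and `bR(T_{cw,2}^{⊠2}) ≤ 16` ("the upper bound is immediate
by submultiplicativity", §3.3). [cite: ConnerGesmundoLandsbergVentura2022, Thm. 1.2] -/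
theorem CGLV2022_thm12_upper :
    (∀ q : ℕ, algBorderRank (kroneckerPow (cwTensor ℂ q) 2) ≤ (q + 2) ^ 2) ∧
    (∀ q : ℕ, algBorderRank (kroneckerPow (cwTensor ℂ q) 3) ≤ (q + 2) ^ 3) ∧
    algBorderRank (kroneckerPow (cwTensor ℂ 2) 2) ≤ 16 :=
  ⟨fun q => algBorderRank_kroneckerPow_cwTensor_le ℂ q 2,
    fun q => algBorderRank_kroneckerPow_cwTensor_le ℂ q 3,
    (algBorderRank_kroneckerPow_cwTensor_le ℂ 2 2).trans (by norm_num)⟩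

/-! ## The projections `A^{⊗N} → K^{2p+1}` -/

section Projections

variable (K : Type u) [CommRing K]

/-- **The projection `φ₂ : A^{⊗2} → A' = ⟨e₀, e₁, e₂⟩` of CGLV Thm. 3.3** (proof):
`φ₂(a₀₀) = φ₂(a₀₁) = φ₂(a₁₀) = e₀ + e₁`, `φ₂(a₁₁) = e₀`, `φ₂(a₀₂) = φ₂(a₂₀) = e₁ + e₂`,
`φ₂(a₃₃) = φ₂(a₂₁) = e₂`, `φ₂(a₀ᵢ) = φ₂(aᵢ₀) = e₁` (`3 ≤ i ≤ q`), all other `a_{ij} ↦ 0`; as the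
`3 × (q+1)²` matrix with entry `(e, a)` = the coefficient of `e_e` in `φ₂(a_{a 0, a 1})`.
[cite: ConnerGesmundoLandsbergVentura2022, Thm. 3.3 (proof)] -/
def cglvPhi2 (q : ℕ) : Matrix (Fin 3) (Fin 2 → Fin (q + 1)) K :=
  Matrix.of fun e a =>
    if ((a 0 : ℕ) = 0 ∧ (a 1 : ℕ) ≤ 1) ∨ ((a 0 : ℕ) = 1 ∧ (a 1 : ℕ) = 0) then
      (if (e : ℕ) = 2 then 0 else 1)
    else if (a 0 : ℕ) = 1 ∧ (a 1 : ℕ) = 1 then (if (e : ℕ) = 0 then 1 else 0)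
    else if ((a 0 : ℕ) = 0 ∧ (a 1 : ℕ) = 2) ∨ ((a 0 : ℕ) = 2 ∧ (a 1 : ℕ) = 0) then
      (if (e : ℕ) = 0 then 0 else 1)
    else if ((a 0 : ℕ) = 3 ∧ (a 1 : ℕ) = 3) ∨ ((a 0 : ℕ) = 2 ∧ (a 1 : ℕ) = 1) then
      (if (e : ℕ) = 2 then 1 else 0)
    else if ((a 0 : ℕ) = 0 ∧ 3 ≤ (a 1 : ℕ)) ∨ ((a 1 : ℕ) = 0 ∧ 3 ≤ (a 0 : ℕ)) then
      (if (e : ℕ) = 1 then 1 else 0)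
    else 0

/-- An explicit "sufficiently generic" projection `A^{⊗2} → K⁵` for `q = 2` (ours; `0/1` table,
`13` ones; entry `[e][a 0][a 1]`). [cite: ConnerGesmundoLandsbergVentura2022, §3.3 (first paragraph)] -/
def cglvPhiSq2Table : Fin 5 → Fin 3 → Fin 3 → ℕ :=
  ![![![0, 1, 1], ![0, 0, 0], ![0, 1, 0]],
    ![![1, 0, 0], ![0, 1, 0], ![0, 0, 0]],
    ![![0, 1, 0], ![0, 0, 0], ![1, 0, 0]],
    ![![0, 0, 0], ![1, 0, 0], ![0, 1, 1]],
    ![![1, 0, 0], ![0, 0, 1], ![0, 0, 1]]]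

/-- The projection `A^{⊗2} → K⁵` for `q = 2` as a matrix. [cite: ConnerGesmundoLandsbergVentura2022, §3.3 (first paragraph)] -/
def cglvPhiSq2 : Matrix (Fin 5) (Fin 2 → Fin 3) K :=
  Matrix.of fun e a => (cglvPhiSq2Table e (a 0) (a 1) : K)

/-- An explicit "sufficiently generic" projection `A^{⊗2} → K⁵` for `q = 3` (ours; `0/1` table,
`19` ones; entry `[e][a 0][a 1]`). [cite: ConnerGesmundoLandsbergVentura2022, Thm. 3.3 (proof, case q = 3)] -/
def cglvPhiSq3Table : Fin 5 → Fin 4 → Fin 4 → ℕ :=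
  ![![![1, 0, 0, 0], ![0, 0, 1, 0], ![0, 0, 1, 1], ![0, 1, 0, 0]],
    ![![0, 1, 0, 0], ![0, 0, 0, 0], ![1, 0, 0, 0], ![0, 0, 0, 0]],
    ![![0, 0, 1, 1], ![0, 1, 0, 0], ![0, 1, 0, 0], ![1, 0, 0, 0]],
    ![![0, 0, 1, 0], ![0, 0, 0, 0], ![0, 0, 0, 0], ![0, 0, 1, 0]],
    ![![0, 0, 0, 1], ![1, 0, 0, 0], ![0, 0, 0, 0], ![1, 1, 0, 1]]]

/-- The projection `A^{⊗2} → K⁵` for `q = 3` as a matrix. [cite: ConnerGesmundoLandsbergVentura2022, Thm. 3.3 (proof, case q = 3)] -/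
def cglvPhiSq3 : Matrix (Fin 5) (Fin 2 → Fin 4) K :=
  Matrix.of fun e a => (cglvPhiSq3Table e (a 0) (a 1) : K)

/-- An explicit "sufficiently generic" projection `A^{⊗3} → K⁵` for the Kronecker CUBE of `T_{cw,2}`
(ours; `0/1` table, `23` ones; entry `[e][a 0][a 1][a 2]`). [cite: ConnerGesmundoLandsbergVentura2022, Thm. 1.2 (q = 2, cube)] -/
def cglvPhiCube2Table : Fin 5 → Fin 3 → Fin 3 → Fin 3 → ℕ :=
  ![![![![1, 0, 0], ![0, 0, 1], ![1, 0, 0]], ![![0, 0, 0], ![1, 1, 0], ![0, 0, 0]],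
      ![![0, 0, 0], ![0, 0, 0], ![0, 0, 0]]],
    ![![![0, 0, 0], ![0, 0, 0], ![0, 0, 0]], ![![0, 0, 1], ![0, 0, 0], ![0, 0, 0]],
      ![![0, 0, 0], ![0, 0, 0], ![1, 1, 0]]],
    ![![![0, 1, 0], ![1, 1, 0], ![0, 0, 0]], ![![1, 0, 0], ![0, 0, 0], ![0, 0, 0]],
      ![![0, 0, 0], ![0, 0, 0], ![0, 0, 0]]],
    ![![![1, 0, 0], ![0, 0, 0], ![0, 0, 0]], ![![0, 0, 1], ![0, 0, 0], ![0, 1, 0]],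
      ![![0, 0, 1], ![0, 1, 0], ![0, 0, 0]]],
    ![![![0, 0, 0], ![1, 0, 0], ![0, 0, 0]], ![![0, 0, 0], ![0, 0, 1], ![0, 0, 0]],
      ![![0, 0, 1], ![0, 1, 1], ![0, 1, 0]]]]

/-- The projection `A^{⊗3} → K⁵` for the cube of `T_{cw,2}` as a matrix. [cite: ConnerGesmundoLandsbergVentura2022, Thm. 1.2 (q = 2, cube)] -/
def cglvPhiCube2 : Matrix (Fin 5) (Fin 3 → Fin 3) K :=
  Matrix.of fun e a => (cglvPhiCube2Table e (a 0) (a 1) (a 2) : K)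

end Projections

/-! ## The four rank facts -/

section Facts

/-- **CGLV Thm. 3.3 (proof), the rank**: for every `q ≥ 4`, the `p = 1` Koszul flattening of
`T_q = φ₂(T_{cw,q}^{⊠2}) ∈ A' ⊗ B^{⊗2} ⊗ C^{⊗2}`, `(T_q)^{∧1}_{A'} : A' ⊗ B^{⊗2*} → Λ²A' ⊗ C^{⊗2}`, has
"`rank((T_q)^{∧1}_{A'}) = 2(q+2)²`" (printed; proved there by induction on `q` from a computer check at
`q = 4`, and again in §3.5 by the `𝔖_{q-3} × 𝔖_{q-3}` isotypic decomposition with blocks of rank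
`72, 12, 12, 2`).  Matrix `3(q+1)² × 3(q+1)²`; checked when vendored for `4 ≤ q ≤ 8`
(`72, 98, 128, 162, 200`). [cite: ConnerGesmundoLandsbergVentura2022, Thm. 3.3 (proof)] -/
def CGLV2022_thm33_koszulRank : Prop :=
  ∀ q : ℕ, 4 ≤ q →
    (koszulFlattening 1 (cglvPhi2 ℂ q).mulVecLin (kroneckerPow (cwTensor ℂ q) 2)).rank = 2 * (q + 2) ^ 2

/-- **CGLV Thm. 3.3 (proof, case `q = 3`)**: "the result is true by a direct calculation using the
`p = 2` Koszul flattening with a sufficiently generic `ℂ⁵ ⊂ A*`" — for the explicit projection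
`cglvPhiSq3` the `160 × 160` flattening of `T_{cw,3}^{⊠2}` has rank `≥ 150` (`= 150 = C(4,2)·25`,
checked when vendored). [cite: ConnerGesmundoLandsbergVentura2022, Thm. 3.3 (proof, case q = 3)] -/
def CGLV2022_koszulRank_sq_three : Prop :=
  150 ≤ (koszulFlattening 2 (cglvPhiSq3 ℂ).mulVecLin (kroneckerPow (cwTensor ℂ 3) 2)).rank

/-- **CGLV §3.3, first paragraph (`q = 2`)**: "The lower bound `bR(T_{cw,2}^{⊠2}) ≥ 15` follows from
the `p = 2` Koszul flattening" — for the explicit projection `cglvPhiSq2` the `90 × 90` flattening of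
`T_{cw,2}^{⊠2}` has rank `≥ 85` (`= 85`, the generic value, checked when vendored; `⌈85/6⌉ = 15`).
[cite: ConnerGesmundoLandsbergVentura2022, §3.3 (first paragraph)] -/
def CGLV2022_koszulRank_sq_two : Prop :=
  85 ≤ (koszulFlattening 2 (cglvPhiSq2 ℂ).mulVecLin (kroneckerPow (cwTensor ℂ 2) 2)).rank

/-- **CGLV Thm. 1.2, `q = 2`, cube** ("if `q = 2` then `bR(T_{cw,2}^{⊠3}) ≥ 15·3`", printed without
proof): for the explicit projection `cglvPhiCube2 : A^{⊗3} → ℂ⁵` the `270 × 270` `p = 2` flattening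
of `T_{cw,2}^{⊠3}` has rank `≥ 265` (`= 265`, the generic value, checked when vendored;
`⌈265/6⌉ = 45`). [cite: ConnerGesmundoLandsbergVentura2022, Thm. 1.2 (q = 2, cube)] -/
def CGLV2022_koszulRank_cube_two : Prop :=
  265 ≤ (koszulFlattening 2 (cglvPhiCube2 ℂ).mulVecLin (kroneckerPow (cwTensor ℂ 2) 3)).rank

end Facts

/-! ## Reductions -/

section Reductions

/-- `(q+2)² ≤ bR(T_{cw,q}^{⊠2})` for `q ≥ 4`, from the rank of Thm. 3.3 (`2·((q+2)² − 1) < 2(q+2)²`).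
[cite: ConnerGesmundoLandsbergVentura2022, Thm. 3.3] -/
theorem sq_le_algBorderRank_of_thm33 (h : CGLV2022_thm33_koszulRank) {q : ℕ} (hq : 4 ≤ q) :
    (q + 2) ^ 2 ≤ algBorderRank (kroneckerPow (cwTensor ℂ q) 2) := by
  refine le_algBorderRank_of_lt_rank_koszulFlattening 1 (cglvPhi2 ℂ q) _ ?_
  rw [h q hq, (by decide : Nat.choose (2 * 1) 1 = 2)]
  have : 1 ≤ (q + 2) ^ 2 := Nat.one_le_pow _ _ (by omega)
  generalize (q + 2) ^ 2 = s at *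
  omega

/-- `25 ≤ bR(T_{cw,3}^{⊠2})` from the `q = 3` rank (`6·24 = 144 < 150`).
[cite: ConnerGesmundoLandsbergVentura2022, Thm. 3.3] -/
theorem le_algBorderRank_cwTensor_three_sq_of (h : CGLV2022_koszulRank_sq_three) :
    25 ≤ algBorderRank (kroneckerPow (cwTensor ℂ 3) 2) := by
  refine le_algBorderRank_of_lt_rank_koszulFlattening 2 (cglvPhiSq3 ℂ) _ ?_
  rw [(by decide : Nat.choose (2 * 2) 2 = 6)]
  exact lt_of_lt_of_le (by norm_num) h

/-- `15 ≤ bR(T_{cw,2}^{⊠2})` from the `q = 2` rank (`6·14 = 84 < 85`).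
[cite: ConnerGesmundoLandsbergVentura2022, Thm. 1.2] -/
theorem le_algBorderRank_cwTensor_two_sq_of (h : CGLV2022_koszulRank_sq_two) :
    15 ≤ algBorderRank (kroneckerPow (cwTensor ℂ 2) 2) := by
  refine le_algBorderRank_of_lt_rank_koszulFlattening 2 (cglvPhiSq2 ℂ) _ ?_
  rw [(by decide : Nat.choose (2 * 2) 2 = 6)]
  exact lt_of_lt_of_le (by norm_num) h

/-- `15·3 ≤ bR(T_{cw,2}^{⊠3})` from the cube rank (`6·44 = 264 < 265`).
[cite: ConnerGesmundoLandsbergVentura2022, Thm. 1.2] -/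
theorem le_algBorderRank_cwTensor_two_cube_of (h : CGLV2022_koszulRank_cube_two) :
    15 * 3 ≤ algBorderRank (kroneckerPow (cwTensor ℂ 2) 3) := by
  refine le_algBorderRank_of_lt_rank_koszulFlattening 2 (cglvPhiCube2 ℂ) _ ?_
  rw [(by decide : Nat.choose (2 * 2) 2 = 6)]
  exact lt_of_lt_of_le (by norm_num) h

/-- **CGLV Thm. 1.2, first paragraph, from the three flattening ranks**: for all `q > 2`,
`bR(T_{cw,q}^{⊠2}) = (q+2)²`, and `15 ≤ bR(T_{cw,2}^{⊠2}) ≤ 16`.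
[cite: ConnerGesmundoLandsbergVentura2022, Thm. 1.2] -/
theorem CGLV2022_thm12_square_of (h45 : CGLV2022_thm33_koszulRank)
    (h3 : CGLV2022_koszulRank_sq_three) (h2 : CGLV2022_koszulRank_sq_two) : CGLV2022_thm12_square := by
  refine ⟨fun q hq => le_antisymm (algBorderRank_kroneckerPow_cwTensor_le ℂ q 2) ?_,
    le_algBorderRank_cwTensor_two_sq_of h2, CGLV2022_thm12_upper.2.2⟩
  rcases Nat.lt_or_ge q 4 with hq4 | hq4
  · obtain rfl : q = 3 := by omega
    exact le_algBorderRank_cwTensor_three_sq_of h3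
  · exact sq_le_algBorderRank_of_thm33 h45 hq4

end Reductions

end Literature.Computability.AlgebraicComplexity

end
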